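import Literature.MathematicalPhysics.QuantumFieldTheory.Balaban1983to89.T3PrintedRegularMinimiser
import HarnessLib

/-!
# `UnitScaleTiltFluctuationComparisonRegPrSmallBlocksSplit` — STUB 4′ of crux `FluctuationComparisonRegPrL` (stmt-QuantumFields-19935) FROM AN
# INNER-WINDOW COMPARISON AND AN EDGE-BAND OSCILLATION LEMMA (the typed shape of repair (R1) of the cell's FINDING #44/#56)

The registered small-block stub 4′ `stub_logComparisonSmallBlocks` (skeletons v5h/v5i/v5j of 19935; odd `L < 7`) asks, for every `K`, a.e. on
the top window `{PlaqSmall (θBal (K/m)) V}` where both restricted height densities are positive, the two-run comparison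
`|(log ρ_{K+1} + bg′_K) − (log ρ_K + bg_K) − κ_K| ≤ r_K` with `Σ r_K < ∞`.  FINDING #44/#56 (ym-ust-19201-p1 g1): at `L ∈ {3, 5}` the window splits
into an INNER part `{PlaqSmall (θBal (K/m) / C_L) V}` (the action-minimising one-step lift stays inside the next finer window; the large-`L` machinery
applies) and the EDGE BAND `{PlaqSmall θ ∧ ¬ PlaqSmall (θ / C_L)}` (a large-deviation regime of the window-restricted fibre law).  This file proves the
bookkeeping that turns the two regimes into the registered text:

* §1 `aeBound_of_inner_of_edge` — abstract (any `ℕ`-indexed family of measure spaces): an a.e. bound `|Δ_K − κ_K| ≤ r_K` on the inner region and, on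
  the edge region, an a.e. bound `|Δ_K − c_K| ≤ r′_K` around SOME constant `c_K` that `Δ_K` also attains (within `r′_K`) on a NON-NULL part of the inner
  region, give `|Δ_K − κ_K| ≤ r_K + 2r′_K` a.e. on the whole window.  (The common constant is the content: the two regions' relative weight is what a
  tilt of the normalised measures sees.)
* §2 `stub_logComparisonSmallBlocks_of_inner_edge` — the registered 4′ text, token for token, from the two pieces stated with 4′'s own quantifier
  prefix (thresholds first, then `(b₀,p₀)`, `ε₁`, `m₀`, `γ₁`) for a block-size-dependent shrink factor `C : ℕ → ℝ` fixed in advance.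

Pure logic and measure theory; nothing of [Balaban1985UV3] or [King1986] is asserted; neither piece is claimed here.
-/

namespace Summit.QuantumFields.YangMills.Theorems.SmallBlocksSplit

open MeasureTheory Filter
open Literature.MathematicalPhysics.QuantumFieldTheory.Balaban1983to89
open Literature.MathematicalPhysics.QuantumFieldTheory.Balaban1983to89.T3ContinuumYM3Torus
open Literature.MathematicalPhysics.QuantumFieldTheory.Balaban1983to89.T3UnitLawDensityEML (ℰp)
open Literature.MathematicalPhysics.QuantumFieldTheory.Balaban1983to89.T3UnitScaleTilt
open Literature.MathematicalPhysics.QuantumFieldTheory.Balaban1983to89.T3TiltDescent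
open Literature.MathematicalPhysics.QuantumFieldTheory.Balaban1983to89.T3PrintedRegularMinimiser

/-! ## §1 The abstract gluing lemma -/

/-- **INNER BOUND + EDGE OSCILLATION ⇒ WHOLE-WINDOW BOUND.**  For an `ℕ`-indexed family of measures: if `|Δ_K − κ_K| ≤ r_K` a.e. on
`{I_K ∧ G_K ∧ G′_K}` (`Σ r < ∞`), and for every `K` there is a constant `c_K` with `|Δ_K − c_K| ≤ r′_K` a.e. on `{W_K ∧ ¬I_K ∧ G_K ∧ G′_K}` (`Σ r′ < ∞`)
which is moreover attained within `r′_K` on a non-null part of `{I_K ∧ G_K ∧ G′_K}`, then `|Δ_K − κ_K| ≤ r_K + 2r′_K` a.e. on `{W_K ∧ G_K ∧ G′_K}`.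
[cite: King1986, Thm 3.4 (3.9) p.656] -/
theorem aeBound_of_inner_of_edge {X : ℕ → Type*} [∀ K, MeasurableSpace (X K)] (μ : ∀ K, Measure (X K))
    (W I G G' : ∀ K, X K → Prop) (Δ : ∀ K, X K → ℝ)
    (hInner : ∃ (r κ : ℕ → ℝ), Summable r ∧ (∀ K, 0 ≤ r K) ∧
      ∀ K, ∀ᵐ x ∂μ K, I K x → G K x → G' K x → |Δ K x - κ K| ≤ r K)
    (hEdge : ∃ r' : ℕ → ℝ, Summable r' ∧ (∀ K, 0 ≤ r' K) ∧ ∀ K, ∃ c : ℝ,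
      (∀ᵐ x ∂μ K, W K x → ¬ I K x → G K x → G' K x → |Δ K x - c| ≤ r' K) ∧
      (∃ᵐ x ∂μ K, I K x ∧ G K x ∧ G' K x ∧ |Δ K x - c| ≤ r' K)) :
    ∃ (r κ : ℕ → ℝ), Summable r ∧ (∀ K, 0 ≤ r K) ∧
      ∀ K, ∀ᵐ x ∂μ K, W K x → G K x → G' K x → |Δ K x - κ K| ≤ r K := by
  obtain ⟨r, κ, hr, hr0, hI⟩ := hInner
  obtain ⟨r', hr', hr'0, hE⟩ := hEdge
  refine ⟨fun K => r K + 2 * r' K, κ, hr.add (hr'.mul_left 2), fun K => by linarith [hr0 K, hr'0 K], fun K => ?_⟩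
  obtain ⟨c, hEc, hfreq⟩ := hE K
  -- the edge constant is within `r K + r' K` of `κ K`: both bounds hold at some inner point
  obtain ⟨x₀, ⟨hI₀, hG₀, hG'₀, hc₀⟩, hκ₀⟩ := (hfreq.and_eventually (hI K)).exists
  have hcκ : |c - κ K| ≤ r' K + r K := by
    have h1 := hκ₀ hI₀ hG₀ hG'₀
    calc |c - κ K| = |(Δ K x₀ - κ K) - (Δ K x₀ - c)| := by ring_nf
      _ ≤ |Δ K x₀ - κ K| + |Δ K x₀ - c| := abs_sub _ _
      _ ≤ r K + r' K := add_le_add h1 hc₀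
      _ = r' K + r K := add_comm _ _
  filter_upwards [hI K, hEc] with x hIx hEx
  intro hW hG hG'
  by_cases hxI : I K x
  · have := hIx hxI hG hG'
    linarith [hr'0 K]
  · have h2 := hEx hW hxI hG hG'
    calc |Δ K x - κ K| = |(Δ K x - c) + (c - κ K)| := by ring_nf
      _ ≤ |Δ K x - c| + |c - κ K| := abs_add_le _ _
      _ ≤ r' K + (r' K + r K) := add_le_add h2 hcκ
      _ = r K + 2 * r' K := by ring

/-! ## §2 STUB 4′ from the two pieces -/

/-- **STUB 4′ `stub_logComparisonSmallBlocks` FROM (i) THE INNER-WINDOW COMPARISON AND (ii) THE EDGE-BAND OSCILLATION LEMMA**, for a shrink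
factor `C L` fixed per block size (FINDING #44/#56: `C 3 ≳ 1.6–1.7`, `C 5 ≳ 1.1`).  (i) = the registered text with the top window shrunk to
`θBal (K/m) / C L`; (ii) = for every `K` a constant `c_K` such that on the edge band `{PlaqSmall θ ∧ ¬PlaqSmall (θ / C L)}` (both densities positive)
`|Δ_K − c_K| ≤ r′_K` a.e., `Σ r′ < ∞`, and `c_K` is attained within `r′_K` on a non-null subset of the inner window where both densities are positive.
Both pieces carry 4′'s quantifier prefix; the conclusion is 4′ token for token. [cite: King1986, Prop. 3.8-3.9 pp.664-665] -/
theorem stub_logComparisonSmallBlocks_of_inner_edge (C : ℕ → ℝ)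
    (hInner : ∀ (L : ℕ), Odd L → 1 < L → L < 7 → ∃ (b₁ p₁ : ℝ), ∀ (b₀ p₀ : ℝ), b₁ ≤ b₀ → p₁ ≤ p₀ → 0 < b₀ → 2 < p₀ →
      ∃ ε₁ : ℝ, 0 < ε₁ ∧ ∀ (ε₀ : ℝ), 0 < ε₀ → ε₀ ≤ ε₁ → ∃ m₀ : ℕ, ∀ (m : ℕ), m₀ ≤ m →
        ∃ γ₁ : ℝ, 0 < γ₁ ∧ ∀ (F : T3Family) (γ : ℝ), F.L = L → 0 < γ → γ ≤ γ₁ →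
          ∃ (r κ : ℕ → ℝ), Summable r ∧ (∀ K, 0 ≤ r K) ∧
            ∀ K, ∀ᵐ V ∂fieldMeasure (F.P (K / m)) 0 (Matrix.specialUnitaryGroup (Fin 2) ℂ),
              PlaqSmall (θBal F.L γ b₀ p₀ (K / m) / C L) V →
                0 < heightDensity F γ (Nat.div_le_self K m) (histGood F ℰp (θBal F.L γ b₀ p₀) K (K / m)) V →
                0 < heightDensity F γ ((Nat.div_le_self K m).trans (Nat.le_succ K))
                      (histGood F ℰp (θBal F.L γ b₀ p₀) (K + 1) (K / m)) V →
                  |(Real.log (heightDensity F γ ((Nat.div_le_self K m).trans (Nat.le_succ K))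
                        (histGood F ℰp (θBal F.L γ b₀ p₀) (K + 1) (K / m)) V) + bgRegPr' F γ m ε₀ K V) -
                    (Real.log (heightDensity F γ (Nat.div_le_self K m) (histGood F ℰp (θBal F.L γ b₀ p₀) K (K / m)) V) + bgRegPr F γ m ε₀ K V) -
                      κ K| ≤ r K)
    (hEdge : ∀ (L : ℕ), Odd L → 1 < L → L < 7 → ∃ (b₁ p₁ : ℝ), ∀ (b₀ p₀ : ℝ), b₁ ≤ b₀ → p₁ ≤ p₀ → 0 < b₀ → 2 < p₀ →
      ∃ ε₁ : ℝ, 0 < ε₁ ∧ ∀ (ε₀ : ℝ), 0 < ε₀ → ε₀ ≤ ε₁ → ∃ m₀ : ℕ, ∀ (m : ℕ), m₀ ≤ m →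
        ∃ γ₁ : ℝ, 0 < γ₁ ∧ ∀ (F : T3Family) (γ : ℝ), F.L = L → 0 < γ → γ ≤ γ₁ →
          ∃ r' : ℕ → ℝ, Summable r' ∧ (∀ K, 0 ≤ r' K) ∧ ∀ K, ∃ c : ℝ,
            (∀ᵐ V ∂fieldMeasure (F.P (K / m)) 0 (Matrix.specialUnitaryGroup (Fin 2) ℂ),
              PlaqSmall (θBal F.L γ b₀ p₀ (K / m)) V → ¬ PlaqSmall (θBal F.L γ b₀ p₀ (K / m) / C L) V →
                0 < heightDensity F γ (Nat.div_le_self K m) (histGood F ℰp (θBal F.L γ b₀ p₀) K (K / m)) V →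
                0 < heightDensity F γ ((Nat.div_le_self K m).trans (Nat.le_succ K))
                      (histGood F ℰp (θBal F.L γ b₀ p₀) (K + 1) (K / m)) V →
                  |(Real.log (heightDensity F γ ((Nat.div_le_self K m).trans (Nat.le_succ K))
                        (histGood F ℰp (θBal F.L γ b₀ p₀) (K + 1) (K / m)) V) + bgRegPr' F γ m ε₀ K V) -
                    (Real.log (heightDensity F γ (Nat.div_le_self K m) (histGood F ℰp (θBal F.L γ b₀ p₀) K (K / m)) V) + bgRegPr F γ m ε₀ K V) -
                      c| ≤ r' K) ∧
            (∃ᵐ V ∂fieldMeasure (F.P (K / m)) 0 (Matrix.specialUnitaryGroup (Fin 2) ℂ),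
              PlaqSmall (θBal F.L γ b₀ p₀ (K / m) / C L) V ∧
                0 < heightDensity F γ (Nat.div_le_self K m) (histGood F ℰp (θBal F.L γ b₀ p₀) K (K / m)) V ∧
                0 < heightDensity F γ ((Nat.div_le_self K m).trans (Nat.le_succ K))
                      (histGood F ℰp (θBal F.L γ b₀ p₀) (K + 1) (K / m)) V ∧
                  |(Real.log (heightDensity F γ ((Nat.div_le_self K m).trans (Nat.le_succ K))
                        (histGood F ℰp (θBal F.L γ b₀ p₀) (K + 1) (K / m)) V) + bgRegPr' F γ m ε₀ K V) -
                    (Real.log (heightDensity F γ (Nat.div_le_self K m) (histGood F ℰp (θBal F.L γ b₀ p₀) K (K / m)) V) + bgRegPr F γ m ε₀ K V) -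
                      c| ≤ r' K)) :
    ∀ (L : ℕ), Odd L → 1 < L → L < 7 → ∃ (b₁ p₁ : ℝ), ∀ (b₀ p₀ : ℝ), b₁ ≤ b₀ → p₁ ≤ p₀ → 0 < b₀ → 2 < p₀ →
      ∃ ε₁ : ℝ, 0 < ε₁ ∧ ∀ (ε₀ : ℝ), 0 < ε₀ → ε₀ ≤ ε₁ → ∃ m₀ : ℕ, ∀ (m : ℕ), m₀ ≤ m →
        ∃ γ₁ : ℝ, 0 < γ₁ ∧ ∀ (F : T3Family) (γ : ℝ), F.L = L → 0 < γ → γ ≤ γ₁ →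
          ∃ (r κ : ℕ → ℝ), Summable r ∧ (∀ K, 0 ≤ r K) ∧
            ∀ K, ∀ᵐ V ∂fieldMeasure (F.P (K / m)) 0 (Matrix.specialUnitaryGroup (Fin 2) ℂ),
              PlaqSmall (θBal F.L γ b₀ p₀ (K / m)) V →
                0 < heightDensity F γ (Nat.div_le_self K m) (histGood F ℰp (θBal F.L γ b₀ p₀) K (K / m)) V →
                0 < heightDensity F γ ((Nat.div_le_self K m).trans (Nat.le_succ K))
                      (histGood F ℰp (θBal F.L γ b₀ p₀) (K + 1) (K / m)) V →
                  |(Real.log (heightDensity F γ ((Nat.div_le_self K m).trans (Nat.le_succ K))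
                        (histGood F ℰp (θBal F.L γ b₀ p₀) (K + 1) (K / m)) V) + bgRegPr' F γ m ε₀ K V) -
                    (Real.log (heightDensity F γ (Nat.div_le_self K m) (histGood F ℰp (θBal F.L γ b₀ p₀) K (K / m)) V) + bgRegPr F γ m ε₀ K V) -
                      κ K| ≤ r K := by
  intro L hLo hL hL7
  obtain ⟨b₁, p₁, H1⟩ := hInner L hLo hL hL7
  obtain ⟨b₁', p₁', H2⟩ := hEdge L hLo hL hL7
  refine ⟨max b₁ b₁', max p₁ p₁', fun b₀ p₀ hb hp hb₀ hp₀ => ?_⟩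
  obtain ⟨ε₁, hε₁, H1'⟩ := H1 b₀ p₀ ((le_max_left _ _).trans hb) ((le_max_left _ _).trans hp) hb₀ hp₀
  obtain ⟨ε₁', hε₁', H2'⟩ := H2 b₀ p₀ ((le_max_right _ _).trans hb) ((le_max_right _ _).trans hp) hb₀ hp₀
  refine ⟨min ε₁ ε₁', lt_min hε₁ hε₁', fun ε₀ hε₀ hε₀le => ?_⟩
  obtain ⟨m₀, Hm₁⟩ := H1' ε₀ hε₀ (hε₀le.trans (min_le_left _ _))
  obtain ⟨m₀', Hm₂⟩ := H2' ε₀ hε₀ (hε₀le.trans (min_le_right _ _))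
  refine ⟨max m₀ m₀', fun m hm => ?_⟩
  obtain ⟨γ₁, hγ₁, HF₁⟩ := Hm₁ m ((le_max_left _ _).trans hm)
  obtain ⟨γ₁', hγ₁', HF₂⟩ := Hm₂ m ((le_max_right _ _).trans hm)
  refine ⟨min γ₁ γ₁', lt_min hγ₁ hγ₁', fun F γ hFL hγ hγle => ?_⟩
  have hA := HF₁ F γ hFL hγ (hγle.trans (min_le_left _ _))
  have hB := HF₂ F γ hFL hγ (hγle.trans (min_le_right _ _))
  exact aeBound_of_inner_of_edge
    (fun K => fieldMeasure (F.P (K / m)) 0 (Matrix.specialUnitaryGroup (Fin 2) ℂ))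
    (fun K V => PlaqSmall (θBal F.L γ b₀ p₀ (K / m)) V)
    (fun K V => PlaqSmall (θBal F.L γ b₀ p₀ (K / m) / C L) V)
    (fun K V => 0 < heightDensity F γ (Nat.div_le_self K m) (histGood F ℰp (θBal F.L γ b₀ p₀) K (K / m)) V)
    (fun K V => 0 < heightDensity F γ ((Nat.div_le_self K m).trans (Nat.le_succ K))
      (histGood F ℰp (θBal F.L γ b₀ p₀) (K + 1) (K / m)) V)
    (fun K V => (Real.log (heightDensity F γ ((Nat.div_le_self K m).trans (Nat.le_succ K))
        (histGood F ℰp (θBal F.L γ b₀ p₀) (K + 1) (K / m)) V) + bgRegPr' F γ m ε₀ K V) -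
      (Real.log (heightDensity F γ (Nat.div_le_self K m) (histGood F ℰp (θBal F.L γ b₀ p₀) K (K / m)) V) + bgRegPr F γ m ε₀ K V))
    hA hB

end Summit.QuantumFields.YangMills.Theorems.SmallBlocksSplit
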